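import Summits.CriticalPhenomena.CardyFormulaZ2.Theses.CardyBoundaryCoulombGas
import Summits.CriticalPhenomena.CardyFormulaZ2.Theses.CardyTotalPositivity
import Literature.Probability.Percolation.RSW
import Literature.Probability.Percolation.RSWProofs
import Literature.Probability.Percolation.LatticeSymmetry
import Literature.Probability.Percolation.KestenTheoremProofs
import Literature.Probability.Percolation.SharpnessDCTProofs
import Literature.Probability.Percolation.ZdOneArmPowerBound
import Literature.Probability.Percolation.HalfPlaneCriticalProb

/-!
# Disproof of `HalfPlaneOneArmThird` — findings

Crux `stmt-CriticalPhenomena-5662` (`CardyBoundaryCoulombGas.HalfPlaneOneArmThird`, shared verbatim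
with `CardyTotalPositivity.HalfPlaneOneArmThird`): for bond percolation on `ℤ²` at `p = 1/2`,
`log P_n / log n → -1/3`, where `P_n = P[0 ↔ {y₀ = ±n} ∪ {y₁ = n} inside [-n,n]×[0,n]]` is the
half-plane one-arm probability to distance `n`.

Standing adversary file (cdisprove).  Prose only in docstrings; everything else is checked Lean.

Findings so far (see the individual docstrings; everything below is sorry-free):
* `crux_iff` — the crux is literally `ExponentAt half (1/3)` for the parametrised family
  `ExponentAt p β : log P_p[armEvt n] / log n → -β`; the two route copies are definitionally equal
  (`crux_shared`).  The formalisation is faithful: `armEvt n` = {0 ↔ outer boundary of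
  `[-n,n]×[0,n]` inside it} = half-plane one-arm to sup-distance `n`; `P_n > 0` (`pow_le_prob`), so
  `Real.log` never meets its junk value; the `n = 0, 1` terms are `0` and invisible under `atTop`.
* (a) THE PARAMETER IS PINNED (`crux_false_of_ne_half`): the statement with `half` replaced by ANY
  `p ≠ 1/2` is false.  `p = 0`, `p = 1`: the limit exists and is `0` (`exponentAt_zero_iff`,
  `exponentAt_one_iff`); `0 < p < 1/2`: the sequence → `-∞`, no exponent at all
  (`not_exponentAt_of_lt_half`; Kesten `p_c(ℤ²) = 1/2` + sharpness, tree theorems);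
  `p > 1/2`: the limit is `0` (`exponentAt_iff_of_half_lt`; `p_c(ℍ) = 1/2` for the half-plane,
  tree theorem `criticalProb_halfSpace_two`, transported to the crux event by first exit +
  transposition).  So any proof must use BOTH `p_c(ℤ²) ≤ 1/2` (sharpness side) and `p_c(ℍ) ≥ 1/2`
  (Harris side): the exponent `1/3` is a genuinely critical quantity, as expected.
* (b) THE RIGOROUS WINDOW (`exponentAt_half_window`): `ExponentAt half β → α₀ ≤ β ≤ 1`, where
  `α₀ > 0` is the tree's a-priori one-arm exponent (`exists_real_boxToFar_le_rpow_of_le_half`,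
  Nolin 2008 Prop. 14) and `β ≤ 1` comes from RSW (`P_n ≥ 1/(2(n+1))`: a top–bottom crossing of the
  `n × n` square starts on the bottom side; union bound + translation invariance, the proof pattern
  of the tree's `crossingProb_succ_le`).  The crux value `1/3` is strictly inside `[α₀, 1]`, and
  with the universal half-plane exponents `β₂⁺ = 1`, `β₃⁺ = 2` (Nolin 2008 Thm. 24) this is all the
  rigorous `ℤ²` theory constrains: NO refutation from known bounds is possible.
* (c) NO FINITE-MODEL KILL: the statement is a `Tendsto … atTop`; every finite prefix of the
  sequence is irrelevant, so exact small-`n` values (kit job, `P_1 = 7/8`, `P_2` rational) cannot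
  refute it.  NUMERICS (kit job j007830, 20 s smoke run of `compute/hp_onearm/main.py`; the large
  run j007967, `n ≤ 2048`, is attached to the item by the compute daemon when it lands):
  exact `P_1 = 7/8`, `P_2 = 12295/16384 = 0.750427` (enumeration of the `2^22` configurations of the
  half-box), against which the strip estimator gives `0.750293 ± 0.00034` (0.4 σ) — estimator
  validated; `P_4 = 0.61415(64)`, `P_8 = 0.4973(11)`, `P_16 = 0.3981(19)`, `P_32 = 0.3155(31)`,
  `P_64 = 0.2441(51)`; the crux ratio `log P_n / log n = -0.414, -0.352, -0.336, -0.332, -0.333,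
  -0.339` for `n = 2, 4, …, 64` and the local slopes `-log₂(P_{2n}/P_n) = 0.289(2), 0.304(4),
  0.321(8), 0.336(16), 0.370(33)` for `n = 2 → 4, …, 32 → 64`: monotonically approaching `1/3`
  from below within errors; `n^{1/3}·P_n = 0.975, 0.995, 1.003, 1.002, 0.98(2)` for `n = 4, 8, 16, 32,
  64` — flat at amplitude `C ≈ 1.00`, which is why the crux ratio is already `-0.333` at `n = 32`
  (compare Ikhlef–Ponsaing's exact diagonal-strip amplitude `1.1373` used by the picked line
  `ip-passage-stirling`).  No numerical tension with the crux at these scales.  Physics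
  context (references located via crossref this session, texts not materialised — lit services
  degraded; treat as pointers, not quotations): the boundary spin exponent of the `q → 1` Potts model,
  Cardy, Nucl. Phys. B 240 (1984) doi:10.1016/0550-3213(84)90241-4, gives `P_n ≈ n^{-1/3}` for every
  lattice in the universality class; square-lattice series: De'Bell–Essam, J. Phys. C 13 (1980)
  doi:10.1088/0022-3719/13/25/023 (acq-04969).
* FAITHFULNESS (`prob_eq_far`): for `n ≥ 1`, `P_p[armEvt n] = P_p[0 ↔ B(n-1)ᶜ inside the upper
  half-plane]` — the half-BOX confinement of the crux is equivalent (a.s.) to the textbook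
  half-PLANE arm to sup-distance `n` (first exit, `mem_armEvt_of_far`); so no mis-statement hides in
  the choice of the confining region.
* WHY IT RESISTS: it is the universality conjecture for one boundary exponent; the only lattice
  where `β₁⁺ = 1/3` is a theorem is site-`𝕋` (Smirnov–Werner 2001 Thm. 3 via Cardy–Smirnov + SLE₆);
  Grimmett–Manolescu isoradial universality transports only the bulk one-arm and the `2j`-alternating
  exponents between isoradial BOND models (not from site-`𝕋`), so it does not reach this item either.
-/

noncomputable section

namespace Summit.CriticalPhenomena.CardyFormulaZ2.Cruxes.HalfPlaneOneArmThird.Disproof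

open MeasureTheory ProbabilityTheory Filter Topology
open Literature.Probability.Percolation Literature.Probability.LatticeModels

/-! ## The parametrised family -/

/-- The half-box `[-n, n] × [0, n]` of the crux. -/
def halfBox (n : ℕ) : Set (Site 2) := {v | 0 ≤ v 1 ∧ -(n : ℤ) ≤ v 0 ∧ v 0 ≤ n ∧ v 1 ≤ n}

/-- The crux event at scale `n`: `0` is joined inside the half-box to its outer boundary
`{y₀ = n} ∪ {y₀ = -n} ∪ {y₁ = n}`. -/
def armEvt (n : ℕ) : Set (BondConfig (Site 2)) :=
  {ω | ∃ y : Site 2, (y 0 = (n : ℤ) ∨ y 0 = -(n : ℤ) ∨ y 1 = (n : ℤ)) ∧ ω ∈ openConnIn (halfBox n) 0 y}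

/-- `P_p[armEvt n]`. -/
def prob (p : unitInterval) (n : ℕ) : ℝ := (bondPercolation (zdGraph 2) p).real (armEvt n)

/-- "The half-plane one-arm exponent of bond-`ℤ²` at parameter `p` exists and equals `β`":
`log P_p[armEvt n] / log n → -β`.  The crux is `ExponentAt half (1/3)` (`crux_iff`). -/
def ExponentAt (p : unitInterval) (β : ℝ) : Prop :=
  Tendsto (fun n : ℕ ↦ Real.log (prob p n) / Real.log n) atTop (𝓝 (-β))

/-- The crux, unfolded: it is `ExponentAt half (1/3)` on the nose. -/
theorem crux_iff : Theses.CardyBoundaryCoulombGas.HalfPlaneOneArmThird ↔ ExponentAt half (1 / 3) :=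
  Iff.rfl

/-- The two route copies of the item are the same proposition. -/
theorem crux_shared :
    Theses.CardyBoundaryCoulombGas.HalfPlaneOneArmThird ↔
      Theses.CardyTotalPositivity.HalfPlaneOneArmThird := Iff.rfl

/-! ## Junk values and the trivial lower bound -/

/-- At `n = 0` the event is sure (`y = 0` is already on the "boundary"), so `P_0 = 1` and the
`n = 0` term of the sequence is `log 1 / log 0 = 0`. -/
theorem armEvt_zero : armEvt 0 = Set.univ := by
  refine Set.eq_univ_of_forall fun ω => ⟨0, by simp, ?_⟩
  have h0 : (0 : Site 2) ∈ halfBox 0 := by simp [halfBox]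
  exact ⟨h0, h0, SimpleGraph.Reachable.refl _⟩

/-- `P_p[armEvt 0] = 1`. -/
theorem prob_zero_eq_one (p : unitInterval) : prob p 0 = 1 := by
  simp [prob, armEvt_zero]

/-- `(k, 0)` as a site. -/
theorem pt_zero_zero : pt 0 0 = (0 : Site 2) := by
  ext i; fin_cases i <;> simp [pt]

/-- If the `n` bottom-row edges `{(i,0),(i+1,0)}`, `0 ≤ i < n`, are open then the crux event holds
(the bottom row joins `0` to `(n, 0)` inside the half-box). -/
theorem mem_armEvt_of_bottomRowEdges_subset {n : ℕ} {ω : BondConfig (Site 2)}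
    (h : (↑(bottomRowEdges n) : Set (Sym2 (Site 2))) ⊆ ω) : ω ∈ armEvt n := by
  have hmem : ∀ k : ℕ, k ≤ n → pt k 0 ∈ halfBox n := by
    intro k hk
    simp only [halfBox, Set.mem_setOf_eq, pt, Matrix.cons_val_zero, Matrix.cons_val_one,
      Matrix.cons_val_fin_one]
    omega
  have hreach : ∀ k : ℕ, ∀ hk : k ≤ n,
      ((openGraph ω).induce (halfBox n)).Reachable ⟨pt 0 0, hmem 0 (Nat.zero_le n)⟩
        ⟨pt k 0, hmem k hk⟩ := by
    intro k
    induction k with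
    | zero => intro hk; exact SimpleGraph.Reachable.refl _
    | succ k ih =>
      intro hk
      refine (ih (Nat.le_of_succ_le hk)).trans (SimpleGraph.Adj.reachable ?_)
      rw [SimpleGraph.induce_adj, openGraph_adj]
      refine ⟨h ?_, ?_⟩
      · simp only [bottomRowEdges, Finset.coe_image, Finset.coe_range, Set.mem_image, Set.mem_Iio]
        exact ⟨k, Nat.lt_of_succ_le hk, by push_cast; rfl⟩
      · intro heq
        have := congr_fun heq 0
        simp [pt] at this
  refine ⟨pt n 0, Or.inl (by simp [pt]), ?_⟩
  have h0 : (0 : Site 2) ∈ halfBox n := pt_zero_zero ▸ hmem 0 (Nat.zero_le n)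
  refine ⟨h0, hmem n le_rfl, ?_⟩
  have := hreach n le_rfl
  convert this using 2; simp [pt_zero_zero]

/-- **Trivial lower bound** `p ^ n ≤ P_p[armEvt n]` (open bottom row).  In particular `P_n > 0`
for `p > 0`, so along the crux sequence `Real.log` is never evaluated at its junk point `0`. -/
theorem pow_le_prob (p : unitInterval) (n : ℕ) : (p : ℝ) ^ n ≤ prob p n := by
  have hcard : (bottomRowEdges n).card ≤ n := by
    simpa [bottomRowEdges] using (Finset.card_image_le (s := Finset.range n)
      (f := fun i : ℕ => s(pt i 0, pt (i + 1) 0)))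
  calc (p : ℝ) ^ n ≤ (p : ℝ) ^ (bottomRowEdges n).card :=
        pow_le_pow_of_le_one p.2.1 p.2.2 hcard
    _ = (bondPercolation (zdGraph 2) p).real
          {ω | (↑(bottomRowEdges n) : Set (Sym2 (Site 2))) ⊆ ω} :=
        (bondPercolation_real_setOf_subset _ p _ (bottomRowEdges_subset_edgeSet n)).symm
    _ ≤ prob p n := measureReal_mono (fun ω hω => mem_armEvt_of_bottomRowEdges_subset hω)

/-- `P_n ≤ 1`. -/
theorem prob_le_one (p : unitInterval) (n : ℕ) : prob p n ≤ 1 := measureReal_le_one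

/-- `0 ≤ P_n`. -/
theorem prob_nonneg (p : unitInterval) (n : ℕ) : 0 ≤ prob p n := measureReal_nonneg

/-- `P_n > 0` as soon as `p > 0`. -/
theorem prob_pos {p : unitInterval} (hp : 0 < (p : ℝ)) (n : ℕ) : 0 < prob p n :=
  (pow_pos hp n).trans_le (pow_le_prob p n)

/-! ## (a) The parameter `p = 1/2` is load-bearing -/

/-- At `p = 1` the event is almost sure: `P_1[armEvt n] = 1`. -/
theorem prob_one (n : ℕ) : prob 1 n = 1 :=
  le_antisymm (prob_le_one 1 n) (by simpa using pow_le_prob 1 n)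

/-- At `p = 1` the crux sequence is identically `0`, so the limit exists and is `0`:
`ExponentAt 1 β ↔ β = 0`. -/
theorem exponentAt_one_iff (β : ℝ) : ExponentAt 1 β ↔ β = 0 := by
  have h : (fun n : ℕ ↦ Real.log (prob 1 n) / Real.log n) = fun _ => 0 := by
    funext n; simp [prob_one]
  rw [ExponentAt, h, tendsto_const_nhds_iff]
  constructor <;> intro h <;> linarith

/-- `HalfPlaneOneArmThird` with `p = 1` in place of `p = 1/2` is false. -/
theorem crux_false_at_one : ¬ ExponentAt 1 (1 / 3) := by
  rw [exponentAt_one_iff]; norm_num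

/-- At `p = 0` and `n ≥ 1` the event fails surely: the empty configuration joins `0` to nothing. -/
theorem prob_zero {n : ℕ} (hn : 1 ≤ n) : prob 0 n = 0 := by
  have hempty : (∅ : BondConfig (Site 2)) ∉ armEvt n := by
    rintro ⟨y, hy, h0, hyS, hr⟩
    have hbot : (openGraph (∅ : BondConfig (Site 2))).induce (halfBox n) = ⊥ := by
      ext a b
      simp [openGraph_adj]
    rw [hbot, SimpleGraph.reachable_bot] at hr
    have hy0 : y = 0 := by simpa using congrArg Subtype.val hr.symm
    subst hy0
    simp at hy
    omega
  simp only [prob, bondPercolation, setBernoulli_zero, measureReal_def, Measure.dirac_apply,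
    Set.indicator_of_notMem hempty, ENNReal.toReal_zero]

/-- At `p = 0` the crux sequence is identically `0` (`log 0 = 0` is Lean's junk value for
`n ≥ 1`, and `log 1 / log 0 = 0` at `n = 0`), so `ExponentAt 0 β ↔ β = 0`. -/
theorem exponentAt_zero_iff (β : ℝ) : ExponentAt 0 β ↔ β = 0 := by
  have h : (fun n : ℕ ↦ Real.log (prob 0 n) / Real.log n) = fun _ => 0 := by
    funext n
    rcases Nat.eq_zero_or_pos n with rfl | hn
    · simp [prob_zero_eq_one]
    · simp [prob_zero hn]
  rw [ExponentAt, h, tendsto_const_nhds_iff]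
  constructor <;> intro h <;> linarith

/-- `HalfPlaneOneArmThird` with `p = 0` in place of `p = 1/2` is false. -/
theorem crux_false_at_zero : ¬ ExponentAt 0 (1 / 3) := by
  rw [exponentAt_zero_iff]; norm_num

/-! ### Subcritical `0 < p < 1/2`: the sequence diverges to `-∞`, no exponent exists -/

/-- The half-box lies in the box `B(n) = [-n, n]²`. -/
theorem halfBox_subset_box (n : ℕ) : halfBox n ⊆ (↑(box 2 n) : Set (Site 2)) := by
  intro v hv
  simp only [halfBox, Set.mem_setOf_eq] at hv
  simp only [Finset.mem_coe, mem_box, Fin.forall_fin_two]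
  omega

/-- The crux event implies the tree's full-plane one-arm event `{0 ↔ ∂B(n)}` (`siteToBoundary`). -/
theorem armEvt_subset_siteToBoundary (n : ℕ) : armEvt n ⊆ siteToBoundary 2 n := by
  rintro ω ⟨y, hy, h0, hyS, hr⟩
  refine ⟨y, ?_, openConnIn_mono (halfBox_subset_box n) 0 y ⟨h0, hyS, hr⟩⟩
  rw [mem_innerBoundary_iff]
  refine ⟨halfBox_subset_box n hyS, ?_⟩
  have hyB : y ∈ halfBox n := hyS
  simp only [halfBox, Set.mem_setOf_eq] at hyB
  have h10 : (1 : Fin 2) ≠ 0 := by decide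
  have h01 : (0 : Fin 2) ≠ 1 := by decide
  rcases hy with hy | hy | hy
  · refine ⟨y + Pi.single 0 1, ?_, (zdGraph_adj_iff _ _).2 ⟨0, Or.inl rfl⟩⟩
    simp only [mem_box, Fin.forall_fin_two, Pi.add_apply, Pi.single_eq_same,
      Pi.single_eq_of_ne h10]
    omega
  · refine ⟨y - Pi.single 0 1, ?_, (zdGraph_adj_iff _ _).2 ⟨0, Or.inr (by rw [sub_add_cancel])⟩⟩
    simp only [mem_box, Fin.forall_fin_two, Pi.sub_apply, Pi.single_eq_same,
      Pi.single_eq_of_ne h10]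
    omega
  · refine ⟨y + Pi.single 1 1, ?_, (zdGraph_adj_iff _ _).2 ⟨1, Or.inl rfl⟩⟩
    simp only [mem_box, Fin.forall_fin_two, Pi.add_apply, Pi.single_eq_same,
      Pi.single_eq_of_ne h01]
    omega

/-- **Sharpness transfers**: for `p < 1/2 = p_c(ℤ²)` (Kesten, proved in the tree) the crux
probability decays exponentially, `P_p[armEvt n] ≤ e^{-c n}` (Menshikov / Aizenman–Barsky /
Duminil-Copin–Tassion, `DCT16.perc_sharpness_holds`). -/
theorem prob_le_exp_of_lt_half {p : unitInterval} (hp : (p : ℝ) < 1 / 2) :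
    ∃ c : ℝ, 0 < c ∧ ∀ n : ℕ, prob p n ≤ Real.exp (-c * n) := by
  have hpc : (p : ℝ) < criticalProb (zdGraph 2) 0 := by
    rw [show criticalProb (zdGraph 2) 0 = 1 / 2 from kesten_criticalProb_Z2_holds]; exact hp
  obtain ⟨c, hc, h⟩ := DCT16.perc_sharpness_holds (d := 2) le_rfl p hpc
  exact ⟨c, hc, fun n => (measureReal_mono (armEvt_subset_siteToBoundary n)).trans (h n)⟩

/-- `log n ≤ 2 √n`, in `rpow` form. -/
theorem log_le_two_mul_rpow_half (n : ℕ) : Real.log n ≤ 2 * (n : ℝ) ^ (1 / 2 : ℝ) := by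
  have := Real.log_le_rpow_div (Nat.cast_nonneg n) (by norm_num : (0 : ℝ) < 1 / 2)
  linarith

/-- For `0 < p < 1/2` the crux sequence `log P_n / log n` tends to `-∞`. -/
theorem tendsto_atBot_of_lt_half {p : unitInterval} (hp0 : 0 < (p : ℝ)) (hp : (p : ℝ) < 1 / 2) :
    Tendsto (fun n : ℕ ↦ Real.log (prob p n) / Real.log n) atTop atBot := by
  obtain ⟨c, hc, h⟩ := prob_le_exp_of_lt_half hp
  have hcmp : ∀ᶠ n : ℕ in atTop,
      Real.log (prob p n) / Real.log n ≤ -((c / 2) * (n : ℝ) ^ (1 / 2 : ℝ)) := by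
    filter_upwards [eventually_ge_atTop 2] with n hn
    have hn' : (2 : ℝ) ≤ n := by exact_mod_cast hn
    have hnpos : (0 : ℝ) < n := by linarith
    have hlog : 0 < Real.log n := Real.log_pos (by linarith)
    have hP : 0 < prob p n := prob_pos hp0 n
    have h1 : Real.log (prob p n) ≤ -c * n := by
      rw [Real.log_le_iff_le_exp hP]; exact h n
    have h2 := log_le_two_mul_rpow_half n
    have h4 : (n : ℝ) ^ (1 / 2 : ℝ) * (n : ℝ) ^ (1 / 2 : ℝ) = n := by
      rw [← Real.rpow_add hnpos, add_halves, Real.rpow_one]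
    have h6 : 0 ≤ c / 2 * (n : ℝ) ^ (1 / 2 : ℝ) := by positivity
    have h7 : c / 2 * (n : ℝ) ^ (1 / 2 : ℝ) * Real.log n ≤
        c / 2 * (n : ℝ) ^ (1 / 2 : ℝ) * (2 * (n : ℝ) ^ (1 / 2 : ℝ)) :=
      mul_le_mul_of_nonneg_left h2 h6
    have h8 : c / 2 * (n : ℝ) ^ (1 / 2 : ℝ) * (2 * (n : ℝ) ^ (1 / 2 : ℝ)) = c * n := by
      have : c / 2 * (n : ℝ) ^ (1 / 2 : ℝ) * (2 * (n : ℝ) ^ (1 / 2 : ℝ)) =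
          c * ((n : ℝ) ^ (1 / 2 : ℝ) * (n : ℝ) ^ (1 / 2 : ℝ)) := by ring
      rw [this, h4]
    rw [div_le_iff₀ hlog]
    linarith
  refine tendsto_atBot_mono' atTop hcmp ?_
  have hs : Tendsto (fun n : ℕ => (n : ℝ) ^ (1 / 2 : ℝ)) atTop atTop :=
    (tendsto_rpow_atTop (by norm_num : (0 : ℝ) < 1 / 2)).comp tendsto_natCast_atTop_atTop
  exact tendsto_neg_atTop_atBot.comp (hs.const_mul_atTop (by positivity : (0 : ℝ) < c / 2))

/-- **(a) Subcritical parameters are refuted outright**: for `0 < p < 1/2` the statement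
`log P_p[armEvt n] / log n → -β` is false for EVERY `β` (the sequence diverges to `-∞`).  Any proof
of the crux must use that `1/2` is not subcritical, i.e. `p_c(ℤ²) ≤ 1/2` (Kesten's theorem). -/
theorem not_exponentAt_of_lt_half {p : unitInterval} (hp0 : 0 < (p : ℝ)) (hp : (p : ℝ) < 1 / 2)
    (β : ℝ) : ¬ ExponentAt p β :=
  not_tendsto_nhds_of_tendsto_atBot (tendsto_atBot_of_lt_half hp0 hp) _

/-! ## (b) The window at criticality: `α₀ ≤ β ≤ 1` -/

/-- The crux event at scale `n ≥ 1` implies the tree's "box-to-far" event with `r = 1`,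
`R = n - 1`: `0 ∈ B(1)` is joined to a site outside `B(n-1)`. -/
theorem armEvt_subset_boxToFar {n : ℕ} (hn : 1 ≤ n) :
    armEvt n ⊆ {ω | ∃ x ∈ box 2 1, ∃ y ∉ box 2 (n - 1), ω ∈ openConnIn Set.univ x y} := by
  rintro ω ⟨y, hy, h⟩
  refine ⟨0, by simp [mem_box], y, ?_, openConnIn_mono (Set.subset_univ _) 0 y h⟩
  intro hyb
  rw [mem_box] at hyb
  have h0 := hyb 0
  have h1 := hyb 1
  push_cast [Nat.cast_sub hn] at h0 h1
  omega

/-- **A-priori upper bound** (Nolin 2008 Prop. 14, `j = 1`, upper half; tree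
`exists_real_boxToFar_le_rpow_of_le_half`): `P_{1/2}[armEvt n] ≤ C (2/n)^α` for `n ≥ 2`, with the
tree's constants `C, α > 0`. -/
theorem prob_half_le_rpow :
    ∃ C α : ℝ, 0 < C ∧ 0 < α ∧ ∀ n : ℕ, 2 ≤ n → prob half n ≤ C * ((2 : ℝ) / n) ^ α := by
  obtain ⟨C, α, hC, hα, h⟩ := exists_real_boxToFar_le_rpow_of_le_half
  refine ⟨C, α, hC, hα, fun n hn => ?_⟩
  have h1 : 1 ≤ n - 1 := by omega
  have hb := h half (by simp) 1 (n - 1) le_rfl h1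
  have hsub := armEvt_subset_boxToFar (n := n) (by omega)
  refine ((measureReal_mono hsub).trans hb).trans ?_
  have hn' : (2 : ℝ) ≤ n := by exact_mod_cast hn
  have hcast : ((n - 1 : ℕ) : ℝ) = n - 1 := by
    rw [Nat.cast_sub (by omega : 1 ≤ n)]; simp
  rw [hcast, Nat.cast_one]
  have hfrac : (1 : ℝ) / (n - 1) ≤ 2 / n := by
    rw [div_le_div_iff₀ (by linarith) (by linarith)]; linarith
  exact mul_le_mul_of_nonneg_left
    (Real.rpow_le_rpow (div_nonneg zero_le_one (by linarith)) hfrac hα.le) hC.le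

/-- **(b, lower edge of the window)** any half-plane one-arm exponent of bond-`ℤ²` at `p = 1/2` is
at least the tree's a-priori exponent `α₀ > 0`: `ExponentAt half β → α₀ ≤ β`.  (The crux value
`1/3` is not excluded: `α₀` is a tiny RSW constant.) -/
theorem exponentAt_half_lower : ∃ α : ℝ, 0 < α ∧ ∀ β : ℝ, ExponentAt half β → α ≤ β := by
  obtain ⟨C, α, hC, hα, h⟩ := prob_half_le_rpow
  refine ⟨α, hα, fun β hβ => ?_⟩
  set K : ℝ := Real.log C + α * Real.log 2 with hK
  have hg : Tendsto (fun n : ℕ => K / Real.log n - α) atTop (𝓝 (0 - α)) :=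
    (tendsto_const_nhds.div_atTop (Real.tendsto_log_atTop.comp tendsto_natCast_atTop_atTop)).sub tendsto_const_nhds
  rw [zero_sub] at hg
  have hcmp : ∀ᶠ n : ℕ in atTop, Real.log (prob half n) / Real.log n ≤ K / Real.log n - α := by
    filter_upwards [eventually_ge_atTop 2] with n hn
    have hn' : (2 : ℝ) ≤ n := by exact_mod_cast hn
    have hlog : 0 < Real.log n := Real.log_pos (by linarith)
    have hP : 0 < prob half n := prob_pos (by simp) n
    have h2n : 0 < (2 : ℝ) / n := by positivity
    have hle : Real.log (prob half n) ≤ K - α * Real.log n := by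
      have := Real.log_le_log hP (h n hn)
      rw [Real.log_mul hC.ne' (Real.rpow_pos_of_pos h2n α).ne', Real.log_rpow h2n,
        Real.log_div (by norm_num) (by positivity)] at this
      rw [hK]; linarith
    rw [div_sub' (ne_of_gt hlog), div_le_div_iff_of_pos_right hlog]
    linarith
  have := le_of_tendsto_of_tendsto hβ hg hcmp
  linarith

/-- The outer boundary of the half-box, as a set of sites. -/
def tgt (n : ℕ) : Set (Site 2) := {y | y 0 = (n : ℤ) ∨ y 0 = -(n : ℤ) ∨ y 1 = (n : ℤ)}

/-- The crux event is the tree's open crossing event from `{0}` to `tgt n` inside the half-box. -/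
theorem armEvt_eq_openCrossing (n : ℕ) :
    armEvt n = openCrossing (halfBox n) {(0 : Site 2)} (tgt n) := by
  ext ω
  simp [armEvt, tgt]

/-- A top–bottom open crossing of the square `[0, n]²` re-centred at its starting point `x` on the
bottom side is a crux arm in the translated half-box `x + [-n, n] × [0, n]` (no first-exit
argument: `[0, n]² - x ⊆ [-n, n] × [0, n]` for `0 ≤ x₀ ≤ n`). -/
theorem tbCrossing_subset_biUnion (n : ℕ) :
    tbCrossing n n ⊆ ⋃ x ∈ bottomSide n n,
      openCrossing ((· + x) '' halfBox n) ((· + x) '' {(0 : Site 2)}) ((· + x) '' tgt n) := by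
  rintro ω ⟨x, hx, y, hy, hconn⟩
  simp only [Finset.mem_coe, bottomSide, topSide, Finset.mem_filter, mem_rectangle_iff] at hx hy
  refine Set.mem_biUnion (x := x) ?_ ?_
  · simp only [Finset.mem_coe, bottomSide, Finset.mem_filter, mem_rectangle_iff]; exact hx
  refine ⟨x, ⟨0, rfl, zero_add x⟩, y, ⟨y - x, ?_, sub_add_cancel y x⟩, openConnIn_mono ?_ x y hconn⟩
  · simp only [tgt, Set.mem_setOf_eq, Pi.sub_apply]; omega
  · intro v hv
    simp only [Finset.mem_coe, mem_rectangle_iff] at hv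
    refine ⟨v - x, ?_, sub_add_cancel v x⟩
    simp only [halfBox, Set.mem_setOf_eq, Pi.sub_apply]; omega

/-- `|bottomSide n n| ≤ n + 1`. -/
theorem card_bottomSide_le (n : ℕ) : (bottomSide n n).card ≤ n + 1 := by
  have hsub : bottomSide n n ⊆ (Finset.range (n + 1)).image fun k : ℕ => (![(k : ℤ), 0] : Site 2) := by
    intro x hx
    simp only [bottomSide, Finset.mem_filter, mem_rectangle_iff] at hx
    obtain ⟨⟨h0, h1, -, -⟩, h2⟩ := hx
    refine Finset.mem_image.2 ⟨(x 0).toNat, Finset.mem_range.2 (by omega), ?_⟩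
    ext i; fin_cases i
    · simp only [Fin.zero_eta, Matrix.cons_val_zero]; exact Int.toNat_of_nonneg h0
    · simp [h2]
  exact (Finset.card_le_card hsub).trans (Finset.card_image_le.trans (Finset.card_range _).le)

/-- **RSW lower bound**: `(n + 1) · P_{1/2}[armEvt n] ≥ 1/2` — a top–bottom crossing of the square
(probability `≥ 1/2`, Bollobás–Riordan Cor. 3(iii), `crossingProb_half_succ_self_holds` +
transposition) starts at one of the `n + 1` bottom sites, and translation invariance. -/
theorem half_le_succ_mul_prob (n : ℕ) : (1 : ℝ) / 2 ≤ (n + 1) * prob half n := by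
  calc (1 : ℝ) / 2 ≤ crossingProb half n n :=
        half_le_crossingProb_self crossingProb_half_succ_self_holds n
    _ = (bondPercolation (zdGraph 2) half).real (tbCrossing n n) := (real_tbCrossing half n n).symm
    _ ≤ (bondPercolation (zdGraph 2) half).real (⋃ x ∈ bottomSide n n,
          openCrossing ((· + x) '' halfBox n) ((· + x) '' {(0 : Site 2)}) ((· + x) '' tgt n)) :=
        measureReal_mono (tbCrossing_subset_biUnion n) (measure_ne_top _ _)
    _ ≤ ∑ x ∈ bottomSide n n, (bondPercolation (zdGraph 2) half).real
          (openCrossing ((· + x) '' halfBox n) ((· + x) '' {(0 : Site 2)}) ((· + x) '' tgt n)) :=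
        measureReal_biUnion_finset_le _ _
    _ = ∑ _x ∈ bottomSide n n, prob half n := by
        refine Finset.sum_congr rfl fun x _ => ?_
        rw [real_openCrossing_shift, prob, armEvt_eq_openCrossing]
    _ = (bottomSide n n).card * prob half n := by rw [Finset.sum_const, nsmul_eq_mul]
    _ ≤ (n + 1) * prob half n := by
        gcongr
        · exact prob_nonneg half n
        · exact_mod_cast card_bottomSide_le n

/-- **(b, upper edge of the window)** any half-plane one-arm exponent of bond-`ℤ²` at `p = 1/2` is
at most `1`: `ExponentAt half β → β ≤ 1` (`P_n ≥ 1/(4n)`).  With the universal half-plane exponents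
`β₂⁺ = 1`, `β₃⁺ = 2` this is all the rigorous `ℤ²` theory pins down; `1/3 ∈ [α₀, 1]`. -/
theorem exponentAt_half_le_one (β : ℝ) (hβ : ExponentAt half β) : β ≤ 1 := by
  have hg : Tendsto (fun n : ℕ => -Real.log 4 / Real.log n - 1) atTop (𝓝 (0 - 1)) :=
    (tendsto_const_nhds.div_atTop (Real.tendsto_log_atTop.comp tendsto_natCast_atTop_atTop)).sub tendsto_const_nhds
  rw [zero_sub] at hg
  have hcmp : ∀ᶠ n : ℕ in atTop, -Real.log 4 / Real.log n - 1 ≤ Real.log (prob half n) / Real.log n := by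
    filter_upwards [eventually_ge_atTop 2] with n hn
    have hn' : (2 : ℝ) ≤ n := by exact_mod_cast hn
    have hlog : 0 < Real.log n := Real.log_pos (by linarith)
    have hP : (1 : ℝ) / (4 * n) ≤ prob half n := by
      have := half_le_succ_mul_prob n
      rw [div_le_iff₀ (by positivity)]
      nlinarith [prob_nonneg half n]
    have hle : -Real.log 4 - Real.log n ≤ Real.log (prob half n) := by
      have := Real.log_le_log (by positivity) hP
      rw [Real.log_div (by norm_num) (by positivity), Real.log_one, Real.log_mul (by norm_num)
        (by positivity)] at this
      linarith
    rw [div_sub' (ne_of_gt hlog), div_le_div_iff_of_pos_right hlog]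
    linarith
  have := le_of_tendsto_of_tendsto hg hβ hcmp
  linarith

/-- **The window, assembled**: `ExponentAt half β → α₀ ≤ β ≤ 1` for the tree's `α₀ > 0`. -/
theorem exponentAt_half_window : ∃ α : ℝ, 0 < α ∧ ∀ β : ℝ, ExponentAt half β → α ≤ β ∧ β ≤ 1 := by
  obtain ⟨α, hα, h⟩ := exponentAt_half_lower
  exact ⟨α, hα, fun β hβ => ⟨h β hβ, exponentAt_half_le_one β hβ⟩⟩

/-! ### Supercritical `p > 1/2`: the limit exists and is `0` -/

/-- The transposed half-box `[0, n] × [-n, n]` (image of `halfBox n` under `x ↦ (x₁, x₀)`). -/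
def halfBoxT (n : ℕ) : Set (Site 2) := {v | 0 ≤ v 0 ∧ -(n : ℤ) ≤ v 1 ∧ v 1 ≤ n ∧ v 0 ≤ n}

/-- The transposed target. -/
def tgtT (n : ℕ) : Set (Site 2) := {y | y 1 = (n : ℤ) ∨ y 1 = -(n : ℤ) ∨ y 0 = (n : ℤ)}

/-- Transposition maps the half-box onto the transposed half-box. -/
theorem image_transpose_halfBox (n : ℕ) :
    (transposeIso : Site 2 → Site 2) '' halfBox n = halfBoxT n := by
  rw [image_transposeIso]; ext v; simp [halfBox, halfBoxT]

/-- Transposition maps the target onto the transposed target. -/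
theorem image_transpose_tgt (n : ℕ) : (transposeIso : Site 2 → Site 2) '' tgt n = tgtT n := by
  rw [image_transposeIso]; ext v; simp [tgt, tgtT]

/-- Transposition fixes the origin. -/
theorem transposeIso_zero : (transposeIso : Site 2 → Site 2) 0 = 0 := by
  ext i; fin_cases i <;> simp

/-- Transposition fixes `{0}`. -/
theorem image_transpose_zero :
    (transposeIso : Site 2 → Site 2) '' {(0 : Site 2)} = {(0 : Site 2)} := by
  simp only [Set.image_singleton, transposeIso_zero]

/-- The crux probability equals that of the transposed event (coordinate swap symmetry of
`P_p` on `ℤ²`), which lives in the tree's half-space `ℍ = {0 ≤ x₀}`. -/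
theorem prob_eq_transposed (p : unitInterval) (n : ℕ) :
    prob p n = (bondPercolation (zdGraph 2) p).real (openCrossing (halfBoxT n) {(0 : Site 2)} (tgtT n)) := by
  rw [prob, armEvt_eq_openCrossing]
  have h := bondPercolation_real_image transposeIso p (halfBox n) {(0 : Site 2)} (tgt n)
  rw [image_transpose_halfBox, image_transpose_tgt, image_transpose_zero] at h
  exact h.symm

/-- Walks of the open graph induced on `A` whose support lies in `B` give connections in `B`. -/
theorem reachable_induce_of_walk {ω : BondConfig (Site 2)} {A B : Set (Site 2)} {u v : A}
    (W : ((openGraph ω).induce A).Walk u v) (hW : ∀ x ∈ W.support, (x : Site 2) ∈ B) :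
    ∃ (hu : (u : Site 2) ∈ B) (hv : (v : Site 2) ∈ B),
      ((openGraph ω).induce B).Reachable ⟨u, hu⟩ ⟨v, hv⟩ := by
  induction W with
  | nil =>
    rename_i u
    exact ⟨hW u (SimpleGraph.Walk.start_mem_support _), hW u (SimpleGraph.Walk.start_mem_support _),
      SimpleGraph.Reachable.refl _⟩
  | cons h W ih =>
    rename_i u w v
    have hu : (u : Site 2) ∈ B := hW u (SimpleGraph.Walk.start_mem_support _)
    obtain ⟨hw, hv, hr⟩ := ih fun x hx => hW x (by simp [hx])
    refine ⟨hu, hv, SimpleGraph.Reachable.trans (SimpleGraph.Adj.reachable ?_) hr⟩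
    rw [SimpleGraph.induce_adj] at h ⊢
    exact h

/-- **Percolation in `ℍ` forces the (transposed) crux event at every scale**: on lattice
configurations, if the open cluster of the origin computed inside `ℍ = {0 ≤ x₀}` is infinite then
`0` is joined inside `[0, n] × [-n, n]` to the outer boundary of that half-box (first exit of an
open `ℍ`-path to a far point). -/
theorem mem_openCrossing_of_percolates_halfSpace {n : ℕ} {ω : BondConfig (Site 2)}
    (hω : ω ⊆ (zdGraph 2).edgeSet)
    (hperc : ω ∈ restrictConfig (Subtype.val : halfSpace 2 → Site 2) ⁻¹' percolatesAt (halfSpaceOrigin 2)) :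
    ω ∈ openCrossing (halfBoxT n) {(0 : Site 2)} (tgtT n) := by
  classical
  -- a point of the `ℍ`-cluster of the origin outside `B(n)`
  have hinf : (openCluster (restrictConfig (Subtype.val : halfSpace 2 → Site 2) ω)
      (halfSpaceOrigin 2)).Infinite := hperc
  obtain ⟨y, hyC, hyT⟩ := hinf.exists_notMem_finset ((box 2 n).subtype (· ∈ halfSpace 2))
  rw [Finset.mem_subtype] at hyT
  have hy0 : 0 ≤ (y : Site 2) 0 := y.2
  -- an open walk inside `ℍ`
  have hr : ((openGraph ω).induce (halfSpace 2)).Reachable (halfSpaceOrigin 2) y := by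
    rw [induce_openGraph_eq]; exact hyC
  obtain ⟨W⟩ := hr
  -- first exit from the half-box
  set S : Set (halfSpace 2) := {v | (v : Site 2) 0 ≤ n ∧ -(n : ℤ) ≤ (v : Site 2) 1 ∧ (v : Site 2) 1 ≤ n}
    with hS
  have h0S : halfSpaceOrigin 2 ∈ S := by
    simp only [hS, Set.mem_setOf_eq, halfSpaceOrigin, Pi.zero_apply]; omega
  have hyS : y ∉ S := by
    intro h
    simp only [hS, Set.mem_setOf_eq] at h
    apply hyT
    simp only [mem_box, Fin.forall_fin_two]
    omega
  obtain ⟨f, g, hf, hg, hadj, W', -, -, hW'⟩ := exists_prefix_within_edges S W h0S hyS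
  -- the exit vertex `f` lies on the outer boundary of the half-box
  have hadj' : (zdGraph 2).Adj (f : Site 2) (g : Site 2) := by
    rw [SimpleGraph.induce_adj, openGraph_adj] at hadj
    exact hω hadj.1
  have h0 := zdGraph_adj_apply_le hadj' 0
  have h1 := zdGraph_adj_apply_le hadj' 1
  have hg0 : 0 ≤ (g : Site 2) 0 := g.2
  simp only [hS, Set.mem_setOf_eq, not_and_or, not_le] at hf hg
  have hft : (f : Site 2) ∈ tgtT n := by
    simp only [tgtT, Set.mem_setOf_eq]; omega
  -- the prefix walk is a connection inside the half-box
  have hsupp : ∀ x ∈ W'.support, (x : Site 2) ∈ halfBoxT n := by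
    intro x hx
    have := hW' x hx
    simp only [hS, Set.mem_setOf_eq] at this
    simp only [halfBoxT, Set.mem_setOf_eq]
    exact ⟨x.2, this.2.1, this.2.2, this.1⟩
  obtain ⟨hu, hv, hreach⟩ := reachable_induce_of_walk W' hsupp
  exact ⟨0, rfl, f, hft, hu, hv, hreach⟩

/-- **The half-plane percolation probability bounds the crux probability from below**:
`θ_ℍ(p) ≤ P_p[armEvt n]` for every `n`. -/
theorem theta_halfSpace_le_prob (p : unitInterval) (n : ℕ) :
    theta (halfSpaceGraph 2) (halfSpaceOrigin 2) p ≤ prob p n := by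
  change theta ((zdGraph 2).comap (Subtype.val : halfSpace 2 → Site 2)) (halfSpaceOrigin 2) p ≤ _
  rw [theta_comap_eq _ Subtype.val_injective, prob_eq_transposed]
  refine ENNReal.toReal_mono (measure_ne_top _ _) (measure_mono_ae ?_)
  filter_upwards [ae_subset_edgeSet (zdGraph 2) p] with ω hω hperc
  exact mem_openCrossing_of_percolates_halfSpace hω hperc

/-- **`θ_ℍ(p) > 0` for `p > 1/2`**: `p_c(ℍ) = 1/2` for the half-plane of bond-`ℤ²` (tree:
`criticalProb_halfSpace_two`, from Kesten's theorem and long crossings above `1/2`), and `θ_ℍ` is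
monotone (`theta_mono_holds`). -/
theorem theta_halfSpace_pos {p : unitInterval} (hp : 1 / 2 < (p : ℝ)) :
    0 < theta (halfSpaceGraph 2) (halfSpaceOrigin 2) p := by
  have hlt : sInf ({q : ℝ | ∃ h : q ∈ unitInterval, 0 < theta (halfSpaceGraph 2) (halfSpaceOrigin 2) ⟨q, h⟩}
      ∪ {1}) < p := by
    have := criticalProb_halfSpace_two
    unfold criticalProb at this
    rw [this]; exact hp
  have hne : ({q : ℝ | ∃ h : q ∈ unitInterval, 0 < theta (halfSpaceGraph 2) (halfSpaceOrigin 2) ⟨q, h⟩}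
      ∪ {1}).Nonempty := ⟨1, Or.inr rfl⟩
  obtain ⟨a, ha, hap⟩ := exists_lt_of_csInf_lt hne hlt
  rcases ha with ⟨ha01, hθ⟩ | ha1
  · exact hθ.trans_le (theta_mono_holds (halfSpaceGraph 2) (halfSpaceOrigin 2)
      (show (⟨a, ha01⟩ : unitInterval) ≤ p from hap.le))
  · rw [Set.mem_singleton_iff] at ha1
    exact absurd (ha1 ▸ hap) (not_lt.2 p.2.2)

/-- For `p > 1/2` the crux sequence tends to `0`: `log P_n` is bounded between `log θ_ℍ(p)` and
`0`. -/
theorem tendsto_zero_of_half_lt {p : unitInterval} (hp : 1 / 2 < (p : ℝ)) :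
    Tendsto (fun n : ℕ ↦ Real.log (prob p n) / Real.log n) atTop (𝓝 0) := by
  have hθ := theta_halfSpace_pos hp
  set L : ℝ := Real.log (theta (halfSpaceGraph 2) (halfSpaceOrigin 2) p) with hL
  have hlow : Tendsto (fun n : ℕ => L / Real.log n) atTop (𝓝 0) :=
    tendsto_const_nhds.div_atTop (Real.tendsto_log_atTop.comp tendsto_natCast_atTop_atTop)
  refine tendsto_of_tendsto_of_tendsto_of_le_of_le' hlow tendsto_const_nhds ?_ ?_
  · filter_upwards [eventually_ge_atTop 2] with n hn
    have hn' : (2 : ℝ) ≤ n := by exact_mod_cast hn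
    have hlog : 0 < Real.log n := Real.log_pos (by linarith)
    rw [div_le_div_iff_of_pos_right hlog, hL]
    exact Real.log_le_log hθ (theta_halfSpace_le_prob p n)
  · filter_upwards [eventually_ge_atTop 2] with n hn
    have hn' : (2 : ℝ) ≤ n := by exact_mod_cast hn
    have hlog : 0 < Real.log n := Real.log_pos (by linarith)
    have hP : 0 < prob p n := prob_pos (by linarith) n
    exact div_nonpos_of_nonpos_of_nonneg (Real.log_nonpos hP.le (prob_le_one p n)) hlog.le

/-- **(a) Supercritical parameters are refuted**: for `p > 1/2` the limit exists and equals `0`,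
so `ExponentAt p β ↔ β = 0`; any proof of the crux must use that `1/2` is not supercritical for
the HALF-PLANE, i.e. `p_c(ℍ) ≥ 1/2` (Harris' side). -/
theorem exponentAt_iff_of_half_lt {p : unitInterval} (hp : 1 / 2 < (p : ℝ)) (β : ℝ) :
    ExponentAt p β ↔ β = 0 := by
  constructor
  · intro h
    have := tendsto_nhds_unique h (tendsto_zero_of_half_lt hp)
    linarith
  · rintro rfl
    simpa [ExponentAt] using tendsto_zero_of_half_lt hp

/-- **The parameter is pinned: `HalfPlaneOneArmThird` is false at EVERY `p ≠ 1/2`.**  At `p = 0`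
and `p > 1/2` the limit is `0`; for `0 < p < 1/2` there is no limit. -/
theorem crux_false_of_ne_half {p : unitInterval} (hp : (p : ℝ) ≠ 1 / 2) : ¬ ExponentAt p (1 / 3) := by
  rcases lt_or_gt_of_ne hp with hlt | hgt
  · rcases (p.2.1).eq_or_lt with h0 | h0
    · have : p = 0 := Subtype.ext h0.symm
      subst this
      rw [exponentAt_zero_iff]; norm_num
    · exact not_exponentAt_of_lt_half h0 hlt _
  · rw [exponentAt_iff_of_half_lt hgt]; norm_num

/-! ## Faithfulness: the crux event IS the half-plane one-arm event to distance `n`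

The crux confines the open path to the half-BOX `[-n, n] × [0, n]`; the textbook event confines it
to the half-PLANE and asks it to reach sup-distance `n`.  On lattice configurations (`ω ⊆ E(ℤ²)`,
almost sure) the two coincide: stop a half-plane path at its first exit from the open half-box
(`mem_armEvt_of_far`); hence equal probabilities (`prob_eq_far`).  This closes the last point of
the formalisation audit that had only been argued on paper (route review c894e0d7, refuter g41-25). -/

/-- The closed upper half-plane `{0 ≤ x₁}` of `ℤ²`. -/
def uhp : Set (Site 2) := {v | 0 ≤ v 1}

/-- The half-box lies in the upper half-plane. -/
theorem halfBox_subset_uhp (n : ℕ) : halfBox n ⊆ uhp := fun _ hv => hv.1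

/-- A crux arm is a half-plane connection from `0` to a site outside `B(n-1)`. -/
theorem armEvt_subset_far {n : ℕ} (hn : 1 ≤ n) :
    armEvt n ⊆ {ω | ∃ y ∉ box 2 (n - 1), ω ∈ openConnIn uhp 0 y} := by
  rintro ω ⟨y, hy, h⟩
  refine ⟨y, ?_, openConnIn_mono (halfBox_subset_uhp n) 0 y h⟩
  intro hyb
  rw [mem_box] at hyb
  have h0 := hyb 0
  have h1 := hyb 1
  push_cast [Nat.cast_sub hn] at h0 h1
  omega

/-- **First exit**: on a lattice configuration, a half-plane open connection from `0` to a site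
outside `B(n-1)` contains a crux arm — the initial segment up to the first site on the outer
boundary of the half-box. -/
theorem mem_armEvt_of_far {n : ℕ} (hn : 1 ≤ n) {ω : BondConfig (Site 2)}
    (hω : ω ⊆ (zdGraph 2).edgeSet) {y : Site 2} (hy : y ∉ box 2 (n - 1))
    (h : ω ∈ openConnIn uhp 0 y) : ω ∈ armEvt n := by
  classical
  obtain ⟨h0, hyU, hr⟩ := h
  obtain ⟨W⟩ := hr
  set S : Set uhp := {v | -(n : ℤ) < (v : Site 2) 0 ∧ (v : Site 2) 0 < n ∧ (v : Site 2) 1 < n}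
    with hS
  have h0S : (⟨0, h0⟩ : uhp) ∈ S := by
    simp only [hS, Set.mem_setOf_eq, Pi.zero_apply]; omega
  have hy1 : 0 ≤ y 1 := hyU
  have hyS : (⟨y, hyU⟩ : uhp) ∉ S := by
    intro h'
    simp only [hS, Set.mem_setOf_eq] at h'
    apply hy
    rw [mem_box]
    intro i
    fin_cases i <;> push_cast [Nat.cast_sub hn] <;> omega
  obtain ⟨f, g, hf, hg, hadj, W', -, -, hW'⟩ := exists_prefix_within_edges S W h0S hyS
  have hadjO : (openGraph ω).Adj (f : Site 2) (g : Site 2) := by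
    rw [SimpleGraph.induce_adj] at hadj; exact hadj
  have hadj' : (zdGraph 2).Adj (f : Site 2) (g : Site 2) := by
    have := hadjO
    rw [openGraph_adj] at this
    exact hω this.1
  have e0 := zdGraph_adj_apply_le hadj' 0
  have e1 := zdGraph_adj_apply_le hadj' 1
  have hg1 : 0 ≤ (g : Site 2) 1 := g.2
  simp only [hS, Set.mem_setOf_eq, not_and_or, not_lt] at hf hg
  have hgB : (g : Site 2) ∈ halfBox n := by
    simp only [halfBox, Set.mem_setOf_eq]; omega
  have hgt : (g : Site 2) 0 = (n : ℤ) ∨ (g : Site 2) 0 = -(n : ℤ) ∨ (g : Site 2) 1 = (n : ℤ) := by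
    omega
  have hsupp : ∀ x ∈ W'.support, (x : Site 2) ∈ halfBox n := by
    intro x hx
    have := hW' x hx
    simp only [hS, Set.mem_setOf_eq] at this
    simp only [halfBox, Set.mem_setOf_eq]
    exact ⟨x.2, by omega, by omega, by omega⟩
  obtain ⟨hu, hv, hreach⟩ := reachable_induce_of_walk W' hsupp
  have hstep : ((openGraph ω).induce (halfBox n)).Adj ⟨f, hv⟩ ⟨g, hgB⟩ := by
    rw [SimpleGraph.induce_adj]
    exact hadjO
  exact ⟨g, hgt, hu, hgB, hreach.trans hstep.reachable⟩

/-- **The crux probability is the half-plane one-arm probability to distance `n`**: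
`P_p[armEvt n] = P_p[0 ↔ B(n-1)ᶜ inside the upper half-plane]` for `n ≥ 1`. -/
theorem prob_eq_far (p : unitInterval) {n : ℕ} (hn : 1 ≤ n) :
    prob p n = (bondPercolation (zdGraph 2) p).real {ω | ∃ y ∉ box 2 (n - 1), ω ∈ openConnIn uhp 0 y} := by
  refine le_antisymm (measureReal_mono (armEvt_subset_far hn) (measure_ne_top _ _)) ?_
  refine ENNReal.toReal_mono (measure_ne_top _ _) (measure_mono_ae ?_)
  filter_upwards [ae_subset_edgeSet (zdGraph 2) p] with ω hω hfar
  obtain ⟨y, hy, h⟩ := hfar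
  exact mem_armEvt_of_far hn hω hy h

end Summit.CriticalPhenomena.CardyFormulaZ2.Cruxes.HalfPlaneOneArmThird.Disproof

end
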